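import Literature.Geometry.Kaehler.ComplexTorusIntegralHodgeLatticeTopMinimalClassValueGroup
import Literature.Geometry.Kaehler.ComplexTorusMiddleHodgeLatticeMinimalClass
import Literature.Geometry.Kaehler.ComplexTorusIntegralHodgeLatticeSignatureClosedForm
import Literature.Topology.FourManifolds.LatticeFormsPrimitiveSublatticeDiscriminant
import HarnessLib

/-!
# The discriminant of the orthogonal complement of the minimal class:
# `[ℤ : B(γ_p, Hdgᵖ(X, ℤ))] · disc(γ_p^⊥) = sign(e)·(−1)^g · [Hdgᵖ(X, ℤ) : ℤγ_p ⊕ γ_p^⊥] · disc Hdgᵖ(X, ℤ)`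

Layer `Literature/Geometry/Kaehler`, namespace `Literature.Geometry.Kaehler.ComplexTorus`; lane `lit-hodgefound`
(Track 2 foundations library), seat p09, generation 49, row g49-#3. THEOREMS ONLY (0 definitions); no named fact, net debt 0.
g48-#5/#6 (`ComplexTorusIntegralHodgeLatticeTopMinimalClassSplitting`, `…ValueGroup`) split the line of the minimal class `γ_p = θ^{∧p}/(p!·d₁⋯d_p)` off the
integral Hodge lattice `M = Hdgᵖ(X, ℤ)` of a polarised abelian variety (`2p + q = g = j + 2`, type `(d₁, …, d_g)`, `B = ⟨·, γ_q ∧ ·⟩_e`) with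
`J_p · m_p = |B(γ_p, γ_p)|`, `J_p = [M : ℤγ_p ⊕ γ_p^⊥]`, `m_p = [ℤ : B(γ_p, M)]`; g48-#8 computed the discriminant of `θ^⊥ = NS(X)_prim` (`p = 1`, line `ℤθ`).
Here Huybrechts' (0.2) `disc(Λ)·disc(Λ^⊥) = [M : Λ ⊕ Λ^⊥]²·disc(M)` for the LINE `Λ = ℤγ_p` gives the discriminant of `γ_p^⊥` in every degree:

* §0 LATTICE GENERALITIES (any `ℤ`-lattice `V` with a symmetric form `B`, any `γ` with `B(γ, γ) ≠ 0`, `Λ = ℤγ`, any `ℤ`-bases `b` of `V`, `c` of `Λ^⊥`):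
  **`B(γ, γ) · det G_c(Λ^⊥) = [V : Λ ⊕ Λ^⊥]² · det G_b(V)`** (`apply_self_mul_det_orthogonal_line_eq_index_sq_mul`) and, dividing by the line formula
  `[V : Λ ⊕ Λ^⊥]·[ℤ : B(γ, V)] = |B(γ, γ)|` of g48-#5, **`[ℤ : B(γ, V)] · det G_c(Λ^⊥) = sign B(γ, γ) · [V : Λ ⊕ Λ^⊥] · det G_b(V)`**
  (`index_range_mul_det_orthogonal_line_eq`); `det G_c(Λ^⊥) ≠ 0 ⟺ det G_b(V) ≠ 0`.
* §1 THE HODGE LATTICE: `sign B(γ_p, γ_p) = sign(e)·(−1)^g` (g48-#5 §1), so in ANY `ℤ`-bases `b` of `Hdgᵖ(X, ℤ)` and `c` of `γ_p^⊥`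
  **`m_p · det G_c(γ_p^⊥) = sign(e)·(−1)^g · J_p · det G_b(Hdgᵖ(X, ℤ))`** (`IsPolarizationType.index_range_mul_det_orthogonal_minimalClass_eq`), hence
  **`m_p · |disc γ_p^⊥| = J_p · |disc Hdgᵖ(X, ℤ)|`**, `disc γ_p^⊥ ≠ 0` (`B∣Hdgᵖ` is non-degenerate, g46-#1), and with g48-#6 (`m_p = r_p·n_p`,
  `r_p·(p!d₁⋯d_p)(q!d₁⋯d_q) = (g−p)!d₁⋯d_{g−p}`, `J_p·n_p·(p!d₁⋯d_p)((g−p)!d₁⋯d_{g−p}) = g!d₁⋯d_g`) the closed form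
  **`(g!·d₁⋯d_g) · |disc γ_p^⊥| = J_p² · (p!·d₁⋯d_p)²·(q!·d₁⋯d_q) · |disc Hdgᵖ(X, ℤ)|`** (`B(γ_p, γ_p)·disc γ_p^⊥ = J_p²·disc Hdgᵖ`); for `p = 1` this is
  g48-#8's `(g−1)d_{g−1}·n²·disc NS_prim = ±g·d_g·disc NS` with the line `ℤγ₁` in place of `ℤθ`.
* §2 data-free existence form.

## References

* [cite: Huybrechts2016K3, Ch. 14 §0.1 (0.1)–(0.2), §0.2 (PDF p. 333)]
* [cite: Kitaoka1993, Ch. 5 Prop. 5.3.3 (proof)]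
* [cite: Ebeling1994, §1.1 Prop. 1.2]
* [cite: Lange2023AbelianVarietiesComplex, §5.4.1 Thm. 5.4.2 and (5.22)–(5.23) (PDF p. 275); §2.5.3 Thm. 2.5.16, Cor. 2.5.17 (d) (PDF p. 135); §1.7.2 Lemma 1.7.5; §7.3.2 (3)]
* [cite: VoisinHodgeI2002, §6.3.2 Lemma 6.31, Thm. 6.32 (PDF p. 128); §7.1.2 (PDF p. 134)]
-/

noncomputable section

-- `Module ℂ` / `SMulZeroClass ℂ` synthesis on `E [⋀^Fin k]→L[ℝ] ℂ` (as in `ComplexTorusLefschetzDecomposition`)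
set_option maxSynthPendingDepth 3

open Module Function Complex
open LinearMap (BilinForm)
open Literature.LinearAlgebra.Alternating
open Literature.Analysis.Complex (IsOfTypeAt typeSubmodule mem_typeSubmodule_iff_isOfTypeAt)

namespace Literature.Geometry.Kaehler.ComplexTorus

/-! ## §0 Lattice generalities: the discriminant of the orthogonal complement of a line -/

section Generic

variable {V : Type*} [AddCommGroup V]

/-- A `ℤ`-basis of the line `Λ = ℤγ` (for `γ` not torsion). [folklore] -/
private theorem exists_basis_line₉₉ (γ : V) (Λ : Submodule ℤ V) (hΛ : ∀ x, x ∈ Λ ↔ ∃ a : ℤ, a • γ = x) (hγ : ∀ a : ℤ, a • γ = 0 → a = 0) :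
    ∃ b : Basis (Fin 1) ℤ ↥Λ, ∀ i, (b i : V) = γ := by
  have hli : LinearIndependent ℤ (fun _ : Fin 1 ↦ γ) := by
    rw [Fintype.linearIndependent_iff]
    intro g hg i
    rw [Fin.sum_univ_one] at hg
    rw [Subsingleton.elim i 0]
    exact hγ _ hg
  have hΛeq : Submodule.span ℤ (Set.range fun _ : Fin 1 ↦ γ) = Λ := by
    refine le_antisymm (Submodule.span_le.2 (Set.range_subset_iff.2 fun _ ↦ (hΛ _).2 ⟨1, one_zsmul γ⟩)) fun x hx ↦ ?_
    obtain ⟨a, rfl⟩ := (hΛ x).1 hx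
    exact Submodule.smul_mem _ a (Submodule.subset_span ⟨0, rfl⟩)
  refine ⟨(Basis.span hli).map (LinearEquiv.ofEq _ _ hΛeq), fun i ↦ ?_⟩
  rw [Basis.map_apply, LinearEquiv.coe_ofEq_apply, Basis.span_apply]

/-- The value `B(γ, γ) ≠ 0` makes `γ` torsion free. [folklore] -/
private theorem smul_eq_zero_imp₉₉ (B : BilinForm ℤ V) (γ : V) (h0 : B γ γ ≠ 0) (a : ℤ) (ha : a • γ = 0) : a = 0 := by
  have h : B (a • γ) γ = 0 := by rw [ha, map_zero, LinearMap.zero_apply]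
  rw [show B (a • γ) γ = B.flip γ (a • γ) from rfl, map_zsmul, zsmul_eq_mul, mul_eq_zero] at h
  exact h.resolve_right h0

/-- **Huybrechts' (0.2) for a line: `B(γ, γ) · det G_c(Λ^⊥) = [V : Λ ⊕ Λ^⊥]² · det G_b(V)`** for a symmetric bilinear form `B` on a `ℤ`-lattice `V`,
`γ ∈ V` with `B(γ, γ) ≠ 0`, the line `Λ = ℤγ`, and any `ℤ`-bases `b` of `V` and `c` of `Λ^⊥` (`disc Λ = B(γ, γ)`).
[cite: Huybrechts2016K3, Ch. 14 §0.1 (0.2), §0.2 (PDF p. 333)] [cite: Kitaoka1993, Ch. 5 Prop. 5.3.3 (proof)] -/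
theorem apply_self_mul_det_orthogonal_line_eq_index_sq_mul [Module.Finite ℤ V] [Module.Free ℤ V] (B : BilinForm ℤ V) (hB : B.IsSymm)
    (γ : V) (Λ : Submodule ℤ V) (hΛ : ∀ x, x ∈ Λ ↔ ∃ a : ℤ, a • γ = x) (h0 : B γ γ ≠ 0)
    {κ κ' : Type*} [Fintype κ] [DecidableEq κ] [Fintype κ'] [DecidableEq κ'] (b : Basis κ ℤ V) (c : Basis κ' ℤ ↥(B.orthogonal Λ)) :
    B γ γ * (LinearMap.BilinForm.toMatrix c (B.restrict (B.orthogonal Λ))).det =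
      ((Λ ⊔ B.orthogonal Λ).toAddSubgroup.index : ℤ) ^ 2 * (LinearMap.BilinForm.toMatrix b B).det := by
  obtain ⟨bL, hbL⟩ := exists_basis_line₉₉ γ Λ hΛ (smul_eq_zero_imp₉₉ B γ h0)
  have hdet : (LinearMap.BilinForm.toMatrix bL (B.restrict Λ)).det = B γ γ := by
    rw [Matrix.det_unique, LinearMap.BilinForm.toMatrix_apply]
    show B (bL default : V) (bL default : V) = B γ γ
    rw [hbL]
  have h := LinearMap.BilinForm.det_mul_det_orthogonal_eq_index_sq_mul_of_det_ne_zero B Λ hB b bL c (by rw [hdet]; exact h0)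
  rwa [hdet] at h

/-- **`[ℤ : B(γ, V)] · det G_c(Λ^⊥) = sign B(γ, γ) · [V : Λ ⊕ Λ^⊥] · det G_b(V)`**: Huybrechts' (0.2) for the line `Λ = ℤγ` divided by the exact line
formula `[V : Λ ⊕ Λ^⊥] · [ℤ : B(γ, V)] = |B(γ, γ)|` (g48-#5); in absolute values `[ℤ : B(γ, V)] · |det G_c(Λ^⊥)| = [V : Λ ⊕ Λ^⊥] · |det G_b(V)|`, and
`det G_c(Λ^⊥) ≠ 0 ⟺ det G_b(V) ≠ 0`. [cite: Huybrechts2016K3, Ch. 14 §0.1 (0.2), §0.2] [cite: Kitaoka1993, Ch. 5 Prop. 5.3.3 (proof)] [cite: Ebeling1994, §1.1 Prop. 1.2] -/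
theorem index_range_mul_det_orthogonal_line_eq [Module.Finite ℤ V] [Module.Free ℤ V] (B : BilinForm ℤ V) (hB : B.IsSymm)
    (γ : V) (Λ : Submodule ℤ V) (hΛ : ∀ x, x ∈ Λ ↔ ∃ a : ℤ, a • γ = x) (h0 : B γ γ ≠ 0)
    {κ κ' : Type*} [Fintype κ] [DecidableEq κ] [Fintype κ'] [DecidableEq κ'] (b : Basis κ ℤ V) (c : Basis κ' ℤ ↥(B.orthogonal Λ)) :
    ((LinearMap.range (B γ)).toAddSubgroup.index : ℤ) * (LinearMap.BilinForm.toMatrix c (B.restrict (B.orthogonal Λ))).det =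
        (B γ γ).sign * (Λ ⊔ B.orthogonal Λ).toAddSubgroup.index * (LinearMap.BilinForm.toMatrix b B).det ∧
      (LinearMap.range (B γ)).toAddSubgroup.index * (LinearMap.BilinForm.toMatrix c (B.restrict (B.orthogonal Λ))).det.natAbs =
        (Λ ⊔ B.orthogonal Λ).toAddSubgroup.index * (LinearMap.BilinForm.toMatrix b B).det.natAbs ∧
      ((LinearMap.BilinForm.toMatrix c (B.restrict (B.orthogonal Λ))).det ≠ 0 ↔ (LinearMap.BilinForm.toMatrix b B).det ≠ 0) := by
  have h1 := apply_self_mul_det_orthogonal_line_eq_index_sq_mul B hB γ Λ hΛ h0 b c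
  have hJm := index_line_sup_orthogonal_mul_index_range_eq_natAbs B γ Λ hΛ
  have hpos := index_line_sup_orthogonal_pos B γ Λ hΛ h0
  -- `J·m = |B(γ, γ)|` in `ℤ`, `sign·|B| = B`
  have hJm' : ((Λ ⊔ B.orthogonal Λ).toAddSubgroup.index : ℤ) * (LinearMap.range (B γ)).toAddSubgroup.index = ((B γ γ).natAbs : ℤ) := by
    exact_mod_cast hJm
  have hsa : (B γ γ).sign * ((B γ γ).natAbs : ℤ) = B γ γ := Int.sign_mul_natAbs _  -- `sign a * natAbs a = a`
  have hss : (B γ γ).sign * (B γ γ).sign = 1 := by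
    rcases h0.lt_or_gt with h | h
    · rw [Int.sign_eq_neg_one_of_neg h]; norm_num
    · rw [Int.sign_eq_one_of_pos h]; norm_num
  have hJ0 : ((Λ ⊔ B.orthogonal Λ).toAddSubgroup.index : ℤ) ≠ 0 := by exact_mod_cast hpos.1.ne'
  have main : ((LinearMap.range (B γ)).toAddSubgroup.index : ℤ) * (LinearMap.BilinForm.toMatrix c (B.restrict (B.orthogonal Λ))).det =
      (B γ γ).sign * (Λ ⊔ B.orthogonal Λ).toAddSubgroup.index * (LinearMap.BilinForm.toMatrix b B).det := by
    refine mul_left_cancel₀ hJ0 ?_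
    -- `J·(m·D⊥) = sign·J²·D`: multiply (0.2) by `sign` and substitute `sign·|B| = B = ` ... `J·m·sign`
    have h2 : B γ γ = (B γ γ).sign * (((Λ ⊔ B.orthogonal Λ).toAddSubgroup.index : ℤ) * (LinearMap.range (B γ)).toAddSubgroup.index) := by
      rw [hJm', hsa]
    linear_combination (B γ γ).sign * h1 - ((B γ γ).sign * (LinearMap.BilinForm.toMatrix c (B.restrict (B.orthogonal Λ))).det) * h2 -
      (((Λ ⊔ B.orthogonal Λ).toAddSubgroup.index : ℤ) * (LinearMap.range (B γ)).toAddSubgroup.index *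
        (LinearMap.BilinForm.toMatrix c (B.restrict (B.orthogonal Λ))).det) * hss
  have habs := congrArg Int.natAbs main
  simp only [Int.natAbs_mul, Int.natAbs_natCast, Int.natAbs_sign_of_ne_zero h0, one_mul] at habs
  refine ⟨main, habs, ?_⟩
  constructor
  · intro hc hbz
    rw [hbz, Int.natAbs_zero, mul_zero] at habs
    exact (Nat.mul_ne_zero hpos.2.ne' (Int.natAbs_ne_zero.2 hc)) habs
  · intro hb hcz
    rw [hcz, Int.natAbs_zero, mul_zero] at habs
    exact (Nat.mul_ne_zero hpos.1.ne' (Int.natAbs_ne_zero.2 hb)) habs.symm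

/-- `sign a = x` for a unit sign `x = ±1` with `x·a > 0`. [folklore] -/
private theorem sign_eq_of_mul_pos₉₉ {x a : ℤ} (hx : x = 1 ∨ x = -1) (h : 0 < x * a) : a.sign = x := by
  rcases hx with rfl | rfl
  · rw [one_mul] at h
    exact Int.sign_eq_one_of_pos h
  · rw [neg_one_mul, neg_pos] at h
    exact Int.sign_eq_neg_one_of_neg h

/-- The arithmetic of the closed form: `|B|·D' = J²·D`, `|B|·C = N` give `N·D' = C·(J²·D)`. [folklore] -/
private theorem arith₉₉ {a c N D D' J : ℕ} (h1 : a * D' = J ^ 2 * D) (h2 : a * c = N) : N * D' = J ^ 2 * c * D := by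
  subst h2
  rw [mul_right_comm, h1]
  ring

/-- `B·d' = X`, `s·B = N` give `N·d' = s·X`. [folklore] -/
private theorem arith_sign₉₉ {s Bg N d' X : ℤ} (h1 : Bg * d' = X) (h2 : s * Bg = N) : N * d' = s * X := by
  rw [← h2, ← h1, mul_assoc]

/-- Re-reading the degree of the right argument of the Poincaré pairing. [folklore] -/
private theorem poincarePairing_domDomCongr_right₉₉ {ι : Type*} [DecidableEq ι] {E : Type*} [NormedAddCommGroup E] [NormedSpace ℂ E]
    (Φ : (ι → ℝ) ≃L[ℝ] E) {n : ℕ} (e : Fin n ≃ ι) {k l l' : ℕ} (hl : l = l') (h : k + l = n) (h' : k + l' = n)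
    (γ : E [⋀^Fin k]→L[ℝ] ℂ) (δ : E [⋀^Fin l]→L[ℝ] ℂ) :
    poincarePairing Φ e h' γ (δ.domDomCongr (finCongr hl)) = poincarePairing Φ e h γ δ := by
  subst hl; rfl

/-- A cup-product form on `H^{2p}(X, ℤ)` is the Lefschetz form of weight `0`: `B(x, y) = ⟨x, y⟩_e = ⟨x, θ^{∧0} ∧ y⟩_e`. [folklore] -/
private theorem eq_poincarePairing_wedgePow_zero_wedge_of_eq_poincarePairing₉₉ {ι : Type*} [DecidableEq ι] {E : Type*} [NormedAddCommGroup E]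
    [NormedSpace ℂ E] (Φ : (ι → ℝ) ≃L[ℝ] E) {n : ℕ} (e : Fin n ≃ ι) (θ : E [⋀^Fin 2]→L[ℝ] ℂ) {k : ℕ}
    (h : k + k = n) (h₀ : k + (2 * 0 + k) = n) {B : BilinForm ℤ ↥(integralForms Φ k)}
    (hB : ∀ x y : ↥(integralForms Φ k), ((B x y : ℤ) : ℂ) = poincarePairing Φ e h (x : E [⋀^Fin k]→L[ℝ] ℂ) (y : E [⋀^Fin k]→L[ℝ] ℂ))
    (x y : ↥(integralForms Φ k)) :
    ((B x y : ℤ) : ℂ) = poincarePairing Φ e h₀ (x : E [⋀^Fin k]→L[ℝ] ℂ) ((wedgePow θ 0).wedge (y : E [⋀^Fin k]→L[ℝ] ℂ)) := by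
  rw [hB, wedgePow_zero, Literature.Analysis.Complex.oneForm₀, ContinuousAlternatingMap.constOfIsEmpty_one_wedge]
  exact (poincarePairing_domDomCongr_right₉₉ Φ e (Nat.zero_add k).symm h h₀ _ _).symm

/-- The content in degree `0` is `1`: `θ^{∧0} = (0!·(empty product))·θ^{∧0}`. [folklore] -/
private theorem wedgePow_zero_eq_content_smul₉₉ {E : Type*} [NormedAddCommGroup E] [NormedSpace ℂ E] (θ : E [⋀^Fin 2]→L[ℝ] ℂ) {g : ℕ}
    (d : Fin g → ℕ) (h0 : 0 ≤ g) :
    wedgePow θ 0 = ((Nat.factorial 0 * ∏ i : Fin 0, d (Fin.castLE h0 i) : ℕ) : ℂ) • wedgePow θ 0 := by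
  simp

end Generic

/-! ## §1 The Hodge lattice: `m_p · disc(γ_p^⊥) = sign(e)·(−1)^g · J_p · disc Hdgᵖ(X, ℤ)` -/

section HodgeLattice

variable {ι : Type*} [Fintype ι] [DecidableEq ι] {E : Type*} [NormedAddCommGroup E] [NormedSpace ℂ E]
  {Φ : (ι → ℝ) ≃L[ℝ] E} {j n p q : ℕ} {η : E [⋀^Fin 2]→L[ℝ] ℝ} {d : Fin (j + 2) → ℕ}

/-- **THE SIGN OF THE SELF-INTERSECTION OF THE MINIMAL CLASS: `sign B(γ_p, γ_p) = sign(e)·(−1)^g`** (`sign(e)·(p!d₁⋯d_p)²(q!d₁⋯d_q)·B(γ_p, γ_p) = (−1)^g·g!·d₁⋯d_g`,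
g48-#5 §1). [cite: Lange2023AbelianVarietiesComplex, §1.7.2 Lemma 1.7.5; §2.5.3 Cor. 2.5.17 (d) (PDF p. 135); §6.2.4 (PDF p. 310)] -/
theorem IsPolarizationType.sign_apply_minimalClass_self (hd : IsPolarizationType Φ η d) (hη : IsRiemannForm Φ η)
    (hp : p ≤ j + 2) (hq : q ≤ j + 2) (hg : p + (q + p) = j + 2)
    {γq : E [⋀^Fin (2 * q)]→L[ℝ] ℂ} (hγq : wedgePow (ofRealForm η) q = ((q.factorial * ∏ i : Fin q, d (Fin.castLE hq i) : ℕ) : ℂ) • γq)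
    (e : Fin n ≃ ι) (hn : 2 * p + (2 * q + 2 * p) = n) {B : BilinForm ℤ ↥(integralForms Φ (2 * p))}
    (hB : ∀ x y : ↥(integralForms Φ (2 * p)),
      ((B x y : ℤ) : ℂ) = poincarePairing Φ e hn (x : E [⋀^Fin (2 * p)]→L[ℝ] ℂ) (γq.wedge (y : E [⋀^Fin (2 * p)]→L[ℝ] ℂ)))
    (γpZ : ↥(integralForms Φ (2 * p)))
    (hγpZ : wedgePow (ofRealForm η) p = ((p.factorial * ∏ i : Fin p, d (Fin.castLE hp i) : ℕ) : ℂ) • (γpZ : E [⋀^Fin (2 * p)]→L[ℝ] ℂ)) :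
    (B γpZ γpZ).sign = orientationSign Φ e * (-1) ^ j := by
  have h := hd.orientationSign_mul_content_mul_apply_minimalClass_self hη hp hq hg hγpZ hγq e hn hB γpZ rfl
  have hC : (0 : ℤ) < (((p.factorial * ∏ i : Fin p, d (Fin.castLE hp i)) ^ 2 * (q.factorial * ∏ i : Fin q, d (Fin.castLE hq i)) : ℕ) : ℤ) := by
    exact_mod_cast Nat.mul_pos (Nat.pow_pos (Nat.mul_pos (Nat.factorial_pos p) (Finset.prod_pos fun i _ ↦ hd.pos hη _)))
      (Nat.mul_pos (Nat.factorial_pos q) (Finset.prod_pos fun i _ ↦ hd.pos hη _))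
  have hCg : (0 : ℤ) < (((j + 2).factorial * ∏ i, d i : ℕ) : ℤ) := by
    exact_mod_cast Nat.mul_pos (Nat.factorial_pos _) (Finset.prod_pos fun i _ ↦ hd.pos hη i)
  have hs : orientationSign Φ e = 1 ∨ orientationSign Φ e = -1 := Int.eq_one_or_neg_one_of_mul_eq_one (orientationSign_mul_self Φ e)
  have hx : orientationSign Φ e * (-1) ^ j = 1 ∨ orientationSign Φ e * (-1) ^ j = -1 := by
    rcases hs with h1 | h1 <;> rcases neg_one_pow_eq_or ℤ j with h2 | h2 <;> simp [h1, h2]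
  -- `(−1)^j · sign(e) · C · B(γ, γ) = C_g > 0`
  have hpos : 0 < (orientationSign Φ e * (-1) ^ j) *
      ((((p.factorial * ∏ i : Fin p, d (Fin.castLE hp i)) ^ 2 * (q.factorial * ∏ i : Fin q, d (Fin.castLE hq i)) : ℕ) : ℤ) * B γpZ γpZ) := by
    have h' : (orientationSign Φ e * (-1) ^ j) *
        ((((p.factorial * ∏ i : Fin p, d (Fin.castLE hp i)) ^ 2 * (q.factorial * ∏ i : Fin q, d (Fin.castLE hq i)) : ℕ) : ℤ) * B γpZ γpZ) =
        (((j + 2).factorial * ∏ i, d i : ℕ) : ℤ) := by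
      have hj2 : ((-1 : ℤ) ^ j) * (-1) ^ (j + 2) = 1 := by
        rw [← pow_add, show j + (j + 2) = 2 * (j + 1) by ring, pow_mul, neg_one_sq, one_pow]
      linear_combination ((-1 : ℤ) ^ j) * h + (((j + 2).factorial * ∏ i, d i : ℕ) : ℤ) * hj2
    rw [h']
    exact hCg
  have hsB : ((((p.factorial * ∏ i : Fin p, d (Fin.castLE hp i)) ^ 2 * (q.factorial * ∏ i : Fin q, d (Fin.castLE hq i)) : ℕ) : ℤ) * B γpZ γpZ).sign =
      (B γpZ γpZ).sign := by
    rw [Int.sign_mul, Int.sign_eq_one_of_pos hC, one_mul]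
  rw [← hsB]
  exact sign_eq_of_mul_pos₉₉ hx hpos

/-- **THE DISCRIMINANT OF THE ORTHOGONAL COMPLEMENT OF THE MINIMAL CLASS:
`[ℤ : B(γ_p, Hdgᵖ(X, ℤ))] · det G_c(γ_p^⊥) = sign(e)·(−1)^g · [Hdgᵖ(X, ℤ) : ℤγ_p ⊕ γ_p^⊥] · det G_b(Hdgᵖ(X, ℤ))`** in ANY `ℤ`-bases `b` of the Hodge lattice
`M = Hdgᵖ(X, ℤ)` and `c` of `γ_p^⊥` (the `B∣M`-orthogonal of `Λ = ℤγ_p`), together with Huybrechts' (0.2) `B(γ_p, γ_p)·det G_c = J_p²·det G_b`, the absolute form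
**`m_p · |disc γ_p^⊥| = J_p · |disc Hdgᵖ(X, ℤ)|`**, the closed form **`(g!·d₁⋯d_g) · |disc γ_p^⊥| = J_p² · (p!·d₁⋯d_p)²·(q!·d₁⋯d_q) · |disc Hdgᵖ(X, ℤ)|`**, and
`disc γ_p^⊥ ≠ 0`, `disc Hdgᵖ(X, ℤ) ≠ 0` (`B∣Hdgᵖ` is non-degenerate, g46-#1).
[cite: Huybrechts2016K3, Ch. 14 §0.1 (0.2), §0.2 (PDF p. 333)] [cite: Kitaoka1993, Ch. 5 Prop. 5.3.3 (proof)] [cite: Lange2023AbelianVarietiesComplex, §5.4.1 Thm. 5.4.2 and (5.22)–(5.23) (PDF p. 275); §2.5.3 Cor. 2.5.17 (d) (PDF p. 135); §7.3.2 (3)] [cite: VoisinHodgeI2002, §6.3.2 Lemma 6.31, Thm. 6.32 (PDF p. 128)] -/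
theorem IsPolarizationType.index_range_mul_det_orthogonal_minimalClass_eq (hd : IsPolarizationType Φ η d) (hη : IsRiemannForm Φ η)
    (hp : p ≤ j + 2) (hq : q ≤ j + 2) (hg : p + (q + p) = j + 2)
    {γq : E [⋀^Fin (2 * q)]→L[ℝ] ℂ} (hγq : wedgePow (ofRealForm η) q = ((q.factorial * ∏ i : Fin q, d (Fin.castLE hq i) : ℕ) : ℂ) • γq)
    (e : Fin n ≃ ι) (hn : 2 * p + (2 * q + 2 * p) = n) {B : BilinForm ℤ ↥(integralForms Φ (2 * p))}
    (hB : ∀ x y : ↥(integralForms Φ (2 * p)),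
      ((B x y : ℤ) : ℂ) = poincarePairing Φ e hn (x : E [⋀^Fin (2 * p)]→L[ℝ] ℂ) (γq.wedge (y : E [⋀^Fin (2 * p)]→L[ℝ] ℂ)))
    (γM : ↥(AddSubgroup.toIntSubmodule ((integralHodgeClassesIn Φ (2 * p) p).addSubgroupOf (integralForms Φ (2 * p)))))
    (hγM : wedgePow (ofRealForm η) p = ((p.factorial * ∏ i : Fin p, d (Fin.castLE hp i) : ℕ) : ℂ) •
      (((γM : ↥(AddSubgroup.toIntSubmodule ((integralHodgeClassesIn Φ (2 * p) p).addSubgroupOf (integralForms Φ (2 * p))))) : ↥(integralForms Φ (2 * p))) : E [⋀^Fin (2 * p)]→L[ℝ] ℂ))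
    (Λ : Submodule ℤ ↥(AddSubgroup.toIntSubmodule ((integralHodgeClassesIn Φ (2 * p) p).addSubgroupOf (integralForms Φ (2 * p))))) (hΛ : ∀ x, x ∈ Λ ↔ ∃ a : ℤ, a • γM = x)
    {κ κ' : Type*} [Fintype κ] [DecidableEq κ] [Fintype κ'] [DecidableEq κ'] (b : Basis κ ℤ ↥(AddSubgroup.toIntSubmodule ((integralHodgeClassesIn Φ (2 * p) p).addSubgroupOf (integralForms Φ (2 * p)))))
    (c : Basis κ' ℤ ↥((B.restrict (AddSubgroup.toIntSubmodule ((integralHodgeClassesIn Φ (2 * p) p).addSubgroupOf (integralForms Φ (2 * p))))).orthogonal Λ)) :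
    ((LinearMap.range (B.restrict (AddSubgroup.toIntSubmodule ((integralHodgeClassesIn Φ (2 * p) p).addSubgroupOf (integralForms Φ (2 * p)))) γM)).toAddSubgroup.index : ℤ) * (LinearMap.BilinForm.toMatrix c ((B.restrict (AddSubgroup.toIntSubmodule ((integralHodgeClassesIn Φ (2 * p) p).addSubgroupOf (integralForms Φ (2 * p))))).restrict ((B.restrict (AddSubgroup.toIntSubmodule ((integralHodgeClassesIn Φ (2 * p) p).addSubgroupOf (integralForms Φ (2 * p))))).orthogonal Λ))).det =
        orientationSign Φ e * (-1) ^ j * (Λ ⊔ (B.restrict (AddSubgroup.toIntSubmodule ((integralHodgeClassesIn Φ (2 * p) p).addSubgroupOf (integralForms Φ (2 * p))))).orthogonal Λ).toAddSubgroup.index * (LinearMap.BilinForm.toMatrix b (B.restrict (AddSubgroup.toIntSubmodule ((integralHodgeClassesIn Φ (2 * p) p).addSubgroupOf (integralForms Φ (2 * p)))))).det ∧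
      B (γM : ↥(integralForms Φ (2 * p))) (γM : ↥(integralForms Φ (2 * p))) *
          (LinearMap.BilinForm.toMatrix c ((B.restrict (AddSubgroup.toIntSubmodule ((integralHodgeClassesIn Φ (2 * p) p).addSubgroupOf (integralForms Φ (2 * p))))).restrict ((B.restrict (AddSubgroup.toIntSubmodule ((integralHodgeClassesIn Φ (2 * p) p).addSubgroupOf (integralForms Φ (2 * p))))).orthogonal Λ))).det =
        ((Λ ⊔ (B.restrict (AddSubgroup.toIntSubmodule ((integralHodgeClassesIn Φ (2 * p) p).addSubgroupOf (integralForms Φ (2 * p))))).orthogonal Λ).toAddSubgroup.index : ℤ) ^ 2 * (LinearMap.BilinForm.toMatrix b (B.restrict (AddSubgroup.toIntSubmodule ((integralHodgeClassesIn Φ (2 * p) p).addSubgroupOf (integralForms Φ (2 * p)))))).det ∧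
      (LinearMap.range (B.restrict (AddSubgroup.toIntSubmodule ((integralHodgeClassesIn Φ (2 * p) p).addSubgroupOf (integralForms Φ (2 * p)))) γM)).toAddSubgroup.index * (LinearMap.BilinForm.toMatrix c ((B.restrict (AddSubgroup.toIntSubmodule ((integralHodgeClassesIn Φ (2 * p) p).addSubgroupOf (integralForms Φ (2 * p))))).restrict ((B.restrict (AddSubgroup.toIntSubmodule ((integralHodgeClassesIn Φ (2 * p) p).addSubgroupOf (integralForms Φ (2 * p))))).orthogonal Λ))).det.natAbs =
        (Λ ⊔ (B.restrict (AddSubgroup.toIntSubmodule ((integralHodgeClassesIn Φ (2 * p) p).addSubgroupOf (integralForms Φ (2 * p))))).orthogonal Λ).toAddSubgroup.index * (LinearMap.BilinForm.toMatrix b (B.restrict (AddSubgroup.toIntSubmodule ((integralHodgeClassesIn Φ (2 * p) p).addSubgroupOf (integralForms Φ (2 * p)))))).det.natAbs ∧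
      ((j + 2).factorial * ∏ i, d i) * (LinearMap.BilinForm.toMatrix c ((B.restrict (AddSubgroup.toIntSubmodule ((integralHodgeClassesIn Φ (2 * p) p).addSubgroupOf (integralForms Φ (2 * p))))).restrict ((B.restrict (AddSubgroup.toIntSubmodule ((integralHodgeClassesIn Φ (2 * p) p).addSubgroupOf (integralForms Φ (2 * p))))).orthogonal Λ))).det.natAbs =
        (Λ ⊔ (B.restrict (AddSubgroup.toIntSubmodule ((integralHodgeClassesIn Φ (2 * p) p).addSubgroupOf (integralForms Φ (2 * p))))).orthogonal Λ).toAddSubgroup.index ^ 2 *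
          ((p.factorial * ∏ i : Fin p, d (Fin.castLE hp i)) ^ 2 * (q.factorial * ∏ i : Fin q, d (Fin.castLE hq i))) *
            (LinearMap.BilinForm.toMatrix b (B.restrict (AddSubgroup.toIntSubmodule ((integralHodgeClassesIn Φ (2 * p) p).addSubgroupOf (integralForms Φ (2 * p)))))).det.natAbs ∧
      (LinearMap.BilinForm.toMatrix c ((B.restrict (AddSubgroup.toIntSubmodule ((integralHodgeClassesIn Φ (2 * p) p).addSubgroupOf (integralForms Φ (2 * p))))).restrict ((B.restrict (AddSubgroup.toIntSubmodule ((integralHodgeClassesIn Φ (2 * p) p).addSubgroupOf (integralForms Φ (2 * p))))).orthogonal Λ))).det ≠ 0 ∧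
      (LinearMap.BilinForm.toMatrix b (B.restrict (AddSubgroup.toIntSubmodule ((integralHodgeClassesIn Φ (2 * p) p).addSubgroupOf (integralForms Φ (2 * p)))))).det ≠ 0 := by
  haveI : Module.Free ℤ ↥(AddSubgroup.toIntSubmodule ((integralHodgeClassesIn Φ (2 * p) p).addSubgroupOf (integralForms Φ (2 * p)))) := Module.Free.of_basis b
  haveI : Module.Finite ℤ ↥(AddSubgroup.toIntSubmodule ((integralHodgeClassesIn Φ (2 * p) p).addSubgroupOf (integralForms Φ (2 * p)))) := Module.Finite.of_basis b
  have hkq : 2 * p + q = j + 2 := by omega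
  have hBs : B.IsSymm := hd.isSymm_of_eq_poincarePairing_wedge_of_even hη (even_two_mul p) hkq hq hγq e hn hB
  have h0 := (hd.natAbs_apply_minimalClass_self_mul_content_eq hη hp hq hg hγM hγq e hn hB (γM : ↥(integralForms Φ (2 * p))) rfl)
  have h0' : (B.restrict (AddSubgroup.toIntSubmodule ((integralHodgeClassesIn Φ (2 * p) p).addSubgroupOf (integralForms Φ (2 * p))))) γM γM ≠ 0 := h0.2
  have hgen := index_range_mul_det_orthogonal_line_eq (B.restrict (AddSubgroup.toIntSubmodule ((integralHodgeClassesIn Φ (2 * p) p).addSubgroupOf (integralForms Φ (2 * p))))) (hBs.restrict _) γM Λ hΛ h0' b c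
  have hhuy := apply_self_mul_det_orthogonal_line_eq_index_sq_mul (B.restrict (AddSubgroup.toIntSubmodule ((integralHodgeClassesIn Φ (2 * p) p).addSubgroupOf (integralForms Φ (2 * p))))) (hBs.restrict _) γM Λ hΛ h0' b c
  have hsign := hd.sign_apply_minimalClass_self hη hp hq hg hγq e hn hB (γM : ↥(integralForms Φ (2 * p))) hγM
  have hnd := (hd.nondegenerate_finrank_sigPos_sigNeg_integralHodgeClassesIn_of_eq_poincarePairing_wedge hη (show p + p = 2 * p by omega) hkq hq hγq e hn hB).1
  have hdetb : (LinearMap.BilinForm.toMatrix b (B.restrict (AddSubgroup.toIntSubmodule ((integralHodgeClassesIn Φ (2 * p) p).addSubgroupOf (integralForms Φ (2 * p)))))).det ≠ 0 := (LinearMap.BilinForm.nondegenerate_iff_det_ne_zero b).1 hnd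
  have habs := congrArg Int.natAbs hhuy
  simp only [Int.natAbs_mul, Int.natAbs_pow, Int.natAbs_natCast] at habs
  have hsign' : ((B.restrict (AddSubgroup.toIntSubmodule ((integralHodgeClassesIn Φ (2 * p) p).addSubgroupOf (integralForms Φ (2 * p))))) γM γM).sign = orientationSign Φ e * (-1) ^ j := hsign
  refine ⟨?_, hhuy, hgen.2.1, arith₉₉ habs h0.1, hgen.2.2.2 hdetb, hdetb⟩
  exact hgen.1.trans (congrArg (fun t : ℤ ↦ t * ((Λ ⊔ (B.restrict (AddSubgroup.toIntSubmodule ((integralHodgeClassesIn Φ (2 * p) p).addSubgroupOf (integralForms Φ (2 * p))))).orthogonal Λ).toAddSubgroup.index : ℤ) *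
    (LinearMap.BilinForm.toMatrix b (B.restrict (AddSubgroup.toIntSubmodule ((integralHodgeClassesIn Φ (2 * p) p).addSubgroupOf (integralForms Φ (2 * p)))))).det) hsign')

end HodgeLattice

/-! ## §2 Data-free form -/

section DataFree

variable {ι : Type*} [Fintype ι] [DecidableEq ι] {E : Type*} [NormedAddCommGroup E] [NormedSpace ℂ E]
  {Φ : (ι → ℝ) ≃L[ℝ] E} {j p q : ℕ} {η : E [⋀^Fin 2]→L[ℝ] ℝ} {d : Fin (j + 2) → ℕ}

/-- **THE DISCRIMINANT OF `γ_p^⊥`, DATA-FREE** (`2p + q = g`): there are the minimal class `γ_p ∈ M = Hdgᵖ(X, ℤ)` and a symmetric integral Lefschetz form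
`B = ⟨·, γ_q ∧ ·⟩_e` on `H^{2p}(X, ℤ)` such that for the line `Λ = ℤγ_p ⊆ M`, `Λ^⊥` its `B∣M`-orthogonal, and ANY `ℤ`-bases `b` of `M`, `c` of `Λ^⊥`:
`[ℤ : B(γ_p, M)] · det G_c(Λ^⊥) = sign(e)·(−1)^g · [M : Λ ⊕ Λ^⊥] · det G_b(M)`, `B(γ_p, γ_p) · det G_c(Λ^⊥) = [M : Λ ⊕ Λ^⊥]² · det G_b(M)`,
`(g!·d₁⋯d_g)·|det G_c(Λ^⊥)| = [M : Λ ⊕ Λ^⊥]²·(p!d₁⋯d_p)²(q!d₁⋯d_q)·|det G_b(M)|`, both determinants non-zero.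
[cite: Huybrechts2016K3, Ch. 14 §0.1 (0.2), §0.2] [cite: Kitaoka1993, Ch. 5 Prop. 5.3.3 (proof)] [cite: Lange2023AbelianVarietiesComplex, §5.4.1 Thm. 5.4.2 and (5.22)–(5.23) (PDF p. 275); §2.5.3 Thm. 2.5.16, Cor. 2.5.17 (d); §7.3.2 (3)] -/
theorem IsPolarizationType.exists_top_splitting_det_orthogonal (hd : IsPolarizationType Φ η d) (hη : IsRiemannForm Φ η) (hp : p ≤ j + 2) (hq : q ≤ j + 2)
    (hkq : 2 * p + q = j + 2) :
    ∃ (e : Fin (2 * p + (2 * q + 2 * p)) ≃ ι) (γM : ↥(AddSubgroup.toIntSubmodule ((integralHodgeClassesIn Φ (2 * p) p).addSubgroupOf (integralForms Φ (2 * p))))) (B : BilinForm ℤ ↥(integralForms Φ (2 * p))),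
      wedgePow (ofRealForm η) p = ((p.factorial * ∏ i : Fin p, d (Fin.castLE hp i) : ℕ) : ℂ) •
        (((γM : ↥(AddSubgroup.toIntSubmodule ((integralHodgeClassesIn Φ (2 * p) p).addSubgroupOf (integralForms Φ (2 * p))))) : ↥(integralForms Φ (2 * p))) : E [⋀^Fin (2 * p)]→L[ℝ] ℂ) ∧ B.IsSymm ∧
      ∀ (Λ : Submodule ℤ ↥(AddSubgroup.toIntSubmodule ((integralHodgeClassesIn Φ (2 * p) p).addSubgroupOf (integralForms Φ (2 * p))))), (∀ x, x ∈ Λ ↔ ∃ a : ℤ, a • γM = x) →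
        ∀ {κ κ' : Type} [Fintype κ] [DecidableEq κ] [Fintype κ'] [DecidableEq κ'] (b : Basis κ ℤ ↥(AddSubgroup.toIntSubmodule ((integralHodgeClassesIn Φ (2 * p) p).addSubgroupOf (integralForms Φ (2 * p)))))
          (c : Basis κ' ℤ ↥((B.restrict (AddSubgroup.toIntSubmodule ((integralHodgeClassesIn Φ (2 * p) p).addSubgroupOf (integralForms Φ (2 * p))))).orthogonal Λ)),
          ((LinearMap.range (B.restrict (AddSubgroup.toIntSubmodule ((integralHodgeClassesIn Φ (2 * p) p).addSubgroupOf (integralForms Φ (2 * p)))) γM)).toAddSubgroup.index : ℤ) *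
                (LinearMap.BilinForm.toMatrix c ((B.restrict (AddSubgroup.toIntSubmodule ((integralHodgeClassesIn Φ (2 * p) p).addSubgroupOf (integralForms Φ (2 * p))))).restrict ((B.restrict (AddSubgroup.toIntSubmodule ((integralHodgeClassesIn Φ (2 * p) p).addSubgroupOf (integralForms Φ (2 * p))))).orthogonal Λ))).det =
              orientationSign Φ e * (-1) ^ j * (Λ ⊔ (B.restrict (AddSubgroup.toIntSubmodule ((integralHodgeClassesIn Φ (2 * p) p).addSubgroupOf (integralForms Φ (2 * p))))).orthogonal Λ).toAddSubgroup.index * (LinearMap.BilinForm.toMatrix b (B.restrict (AddSubgroup.toIntSubmodule ((integralHodgeClassesIn Φ (2 * p) p).addSubgroupOf (integralForms Φ (2 * p)))))).det ∧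
            B (γM : ↥(integralForms Φ (2 * p))) (γM : ↥(integralForms Φ (2 * p))) *
                (LinearMap.BilinForm.toMatrix c ((B.restrict (AddSubgroup.toIntSubmodule ((integralHodgeClassesIn Φ (2 * p) p).addSubgroupOf (integralForms Φ (2 * p))))).restrict ((B.restrict (AddSubgroup.toIntSubmodule ((integralHodgeClassesIn Φ (2 * p) p).addSubgroupOf (integralForms Φ (2 * p))))).orthogonal Λ))).det =
              ((Λ ⊔ (B.restrict (AddSubgroup.toIntSubmodule ((integralHodgeClassesIn Φ (2 * p) p).addSubgroupOf (integralForms Φ (2 * p))))).orthogonal Λ).toAddSubgroup.index : ℤ) ^ 2 * (LinearMap.BilinForm.toMatrix b (B.restrict (AddSubgroup.toIntSubmodule ((integralHodgeClassesIn Φ (2 * p) p).addSubgroupOf (integralForms Φ (2 * p)))))).det ∧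
            ((j + 2).factorial * ∏ i, d i) * (LinearMap.BilinForm.toMatrix c ((B.restrict (AddSubgroup.toIntSubmodule ((integralHodgeClassesIn Φ (2 * p) p).addSubgroupOf (integralForms Φ (2 * p))))).restrict ((B.restrict (AddSubgroup.toIntSubmodule ((integralHodgeClassesIn Φ (2 * p) p).addSubgroupOf (integralForms Φ (2 * p))))).orthogonal Λ))).det.natAbs =
              (Λ ⊔ (B.restrict (AddSubgroup.toIntSubmodule ((integralHodgeClassesIn Φ (2 * p) p).addSubgroupOf (integralForms Φ (2 * p))))).orthogonal Λ).toAddSubgroup.index ^ 2 *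
                ((p.factorial * ∏ i : Fin p, d (Fin.castLE hp i)) ^ 2 * (q.factorial * ∏ i : Fin q, d (Fin.castLE hq i))) *
                  (LinearMap.BilinForm.toMatrix b (B.restrict (AddSubgroup.toIntSubmodule ((integralHodgeClassesIn Φ (2 * p) p).addSubgroupOf (integralForms Φ (2 * p)))))).det.natAbs ∧
            (LinearMap.BilinForm.toMatrix c ((B.restrict (AddSubgroup.toIntSubmodule ((integralHodgeClassesIn Φ (2 * p) p).addSubgroupOf (integralForms Φ (2 * p))))).restrict ((B.restrict (AddSubgroup.toIntSubmodule ((integralHodgeClassesIn Φ (2 * p) p).addSubgroupOf (integralForms Φ (2 * p))))).orthogonal Λ))).det ≠ 0 ∧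
            (LinearMap.BilinForm.toMatrix b (B.restrict (AddSubgroup.toIntSubmodule ((integralHodgeClassesIn Φ (2 * p) p).addSubgroupOf (integralForms Φ (2 * p)))))).det ≠ 0 := by
  refine (hd.exists_minimalClass_mem_toIntSubmodule hη hp).elim fun γM hγM ↦ ?_
  refine (hd.exists_mem_integralForms_wedgePow_eq_content_smul hq).elim fun γq hγq' ↦ ?_
  have hγqZ := hγq'.1
  have hγq := hγq'.2
  have hcard : Fintype.card ι = 2 * p + (2 * q + 2 * p) := by rw [hd.card_eq]; omega
  let e : Fin (2 * p + (2 * q + 2 * p)) ≃ ι := (Fintype.equivFinOfCardEq hcard).symm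
  refine (exists_bilinForm_eq_poincarePairing_wedge_of_degree Φ hγqZ e rfl).elim fun B hB ↦ ?_
  have hg : p + (q + p) = j + 2 := by omega
  refine ⟨e, γM, B, hγM, hd.isSymm_of_eq_poincarePairing_wedge_of_even hη (even_two_mul p) hkq hq hγq e rfl hB, fun Λ hΛ κ κ' _ _ _ _ b c ↦ ?_⟩
  have h := hd.index_range_mul_det_orthogonal_minimalClass_eq hη hp hq hg hγq e rfl hB γM hγM Λ hΛ b c
  exact ⟨h.1, h.2.1, h.2.2.2.1, h.2.2.2.2.1, h.2.2.2.2.2⟩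

end DataFree

/-! ## §3 The middle degree `g = 2p` (cup product): `n_p · disc(γ_p^⊥) = sign(e) · J_p · disc Hdgᵖ(X, ℤ)` -/

section Middle

variable {ι : Type*} [Fintype ι] [DecidableEq ι] {E : Type*} [NormedAddCommGroup E] [NormedSpace ℂ E]
  {Φ : (ι → ℝ) ≃L[ℝ] E} {j n p : ℕ} {η : E [⋀^Fin 2]→L[ℝ] ℝ} {d : Fin (j + 2) → ℕ}

/-- **THE MIDDLE DEGREE (`g = 2p`, `B = ⟨·,·⟩_e` the cup product of `H^{2p}(X, ℤ)`):
`[ℤ : ⟨γ_p, Hdgᵖ(X, ℤ)⟩] · det G_c(γ_p^⊥) = sign(e) · [Hdgᵖ(X, ℤ) : ℤγ_p ⊕ γ_p^⊥] · det G_b(Hdgᵖ(X, ℤ))`** in any `ℤ`-bases (`(−1)^g = 1`; here `⟨γ_p, H^{2p}(X, ℤ)⟩ = ℤ`,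
g49-#1, so the first factor is the index `n_p` of the intersection numbers of `γ_p` with Hodge classes), the closed form
**`(C(2p, p)·∏_{i<p} d_{p+i}/dᵢ) · det G_c(γ_p^⊥) = sign(e) · J_p² · det G_b(Hdgᵖ(X, ℤ))`** (`sign(e)·⟨γ_p, γ_p⟩ = C(2p, p)·∏ d_{p+i}/dᵢ`, g49-#1 §2), and
`n_p · |disc γ_p^⊥| = J_p · |disc Hdgᵖ(X, ℤ)|`; e.g. a principally polarised abelian fourfold: `6 · disc (θ²/2)^⊥ = sign(e) · J₂² · disc Hdg²(X, ℤ)`, `J₂ ∣ 6`.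
[cite: Huybrechts2016K3, Ch. 14 §0.1 (0.2), §0.2 (PDF p. 333)] [cite: Kitaoka1993, Ch. 5 Prop. 5.3.3 (proof)] [cite: Lange2023AbelianVarietiesComplex, §5.4.1 (5.22)–(5.23) (PDF p. 275); §7.3.1 Lemma 7.3.6, Thm. 7.3.1 (PDF p. 336); §2.5.3 Cor. 2.5.17 (d)] [cite: BenoistDebarre2023SmoothSubvarietiesJacobians, §3 Prop. 3.3] -/
theorem IsPolarizationType.index_range_mul_det_orthogonal_minimalClass_eq_of_middle (hd : IsPolarizationType Φ η d) (hη : IsRiemannForm Φ η)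
    (hp : p ≤ j + 2) (hg : p + p = j + 2) (e : Fin n ≃ ι) (hn : 2 * p + 2 * p = n) {B : BilinForm ℤ ↥(integralForms Φ (2 * p))}
    (hB : ∀ x y : ↥(integralForms Φ (2 * p)),
      ((B x y : ℤ) : ℂ) = poincarePairing Φ e hn (x : E [⋀^Fin (2 * p)]→L[ℝ] ℂ) (y : E [⋀^Fin (2 * p)]→L[ℝ] ℂ))
    (γM : ↥(AddSubgroup.toIntSubmodule ((integralHodgeClassesIn Φ (2 * p) p).addSubgroupOf (integralForms Φ (2 * p)))))
    (hγM : wedgePow (ofRealForm η) p = ((p.factorial * ∏ i : Fin p, d (Fin.castLE hp i) : ℕ) : ℂ) •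
      (((γM : ↥(AddSubgroup.toIntSubmodule ((integralHodgeClassesIn Φ (2 * p) p).addSubgroupOf (integralForms Φ (2 * p))))) : ↥(integralForms Φ (2 * p))) : E [⋀^Fin (2 * p)]→L[ℝ] ℂ))
    (Λ : Submodule ℤ ↥(AddSubgroup.toIntSubmodule ((integralHodgeClassesIn Φ (2 * p) p).addSubgroupOf (integralForms Φ (2 * p))))) (hΛ : ∀ x, x ∈ Λ ↔ ∃ a : ℤ, a • γM = x)
    {κ κ' : Type*} [Fintype κ] [DecidableEq κ] [Fintype κ'] [DecidableEq κ'] (b : Basis κ ℤ ↥(AddSubgroup.toIntSubmodule ((integralHodgeClassesIn Φ (2 * p) p).addSubgroupOf (integralForms Φ (2 * p)))))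
    (c : Basis κ' ℤ ↥((B.restrict (AddSubgroup.toIntSubmodule ((integralHodgeClassesIn Φ (2 * p) p).addSubgroupOf (integralForms Φ (2 * p))))).orthogonal Λ)) :
    ((LinearMap.range (B.restrict (AddSubgroup.toIntSubmodule ((integralHodgeClassesIn Φ (2 * p) p).addSubgroupOf (integralForms Φ (2 * p)))) γM)).toAddSubgroup.index : ℤ) * (LinearMap.BilinForm.toMatrix c ((B.restrict (AddSubgroup.toIntSubmodule ((integralHodgeClassesIn Φ (2 * p) p).addSubgroupOf (integralForms Φ (2 * p))))).restrict ((B.restrict (AddSubgroup.toIntSubmodule ((integralHodgeClassesIn Φ (2 * p) p).addSubgroupOf (integralForms Φ (2 * p))))).orthogonal Λ))).det =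
        orientationSign Φ e * (Λ ⊔ (B.restrict (AddSubgroup.toIntSubmodule ((integralHodgeClassesIn Φ (2 * p) p).addSubgroupOf (integralForms Φ (2 * p))))).orthogonal Λ).toAddSubgroup.index * (LinearMap.BilinForm.toMatrix b (B.restrict (AddSubgroup.toIntSubmodule ((integralHodgeClassesIn Φ (2 * p) p).addSubgroupOf (integralForms Φ (2 * p)))))).det ∧
      (((j + 2).choose p * ((∏ i, d i) / ((∏ i : Fin p, d (Fin.castLE hp i)) * ∏ i : Fin p, d (Fin.castLE hp i))) : ℕ) : ℤ) *
          (LinearMap.BilinForm.toMatrix c ((B.restrict (AddSubgroup.toIntSubmodule ((integralHodgeClassesIn Φ (2 * p) p).addSubgroupOf (integralForms Φ (2 * p))))).restrict ((B.restrict (AddSubgroup.toIntSubmodule ((integralHodgeClassesIn Φ (2 * p) p).addSubgroupOf (integralForms Φ (2 * p))))).orthogonal Λ))).det =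
        orientationSign Φ e * (((Λ ⊔ (B.restrict (AddSubgroup.toIntSubmodule ((integralHodgeClassesIn Φ (2 * p) p).addSubgroupOf (integralForms Φ (2 * p))))).orthogonal Λ).toAddSubgroup.index : ℤ) ^ 2 * (LinearMap.BilinForm.toMatrix b (B.restrict (AddSubgroup.toIntSubmodule ((integralHodgeClassesIn Φ (2 * p) p).addSubgroupOf (integralForms Φ (2 * p)))))).det) ∧
      (LinearMap.range (B.restrict (AddSubgroup.toIntSubmodule ((integralHodgeClassesIn Φ (2 * p) p).addSubgroupOf (integralForms Φ (2 * p)))) γM)).toAddSubgroup.index * (LinearMap.BilinForm.toMatrix c ((B.restrict (AddSubgroup.toIntSubmodule ((integralHodgeClassesIn Φ (2 * p) p).addSubgroupOf (integralForms Φ (2 * p))))).restrict ((B.restrict (AddSubgroup.toIntSubmodule ((integralHodgeClassesIn Φ (2 * p) p).addSubgroupOf (integralForms Φ (2 * p))))).orthogonal Λ))).det.natAbs =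
        (Λ ⊔ (B.restrict (AddSubgroup.toIntSubmodule ((integralHodgeClassesIn Φ (2 * p) p).addSubgroupOf (integralForms Φ (2 * p))))).orthogonal Λ).toAddSubgroup.index * (LinearMap.BilinForm.toMatrix b (B.restrict (AddSubgroup.toIntSubmodule ((integralHodgeClassesIn Φ (2 * p) p).addSubgroupOf (integralForms Φ (2 * p)))))).det.natAbs ∧
      (LinearMap.BilinForm.toMatrix c ((B.restrict (AddSubgroup.toIntSubmodule ((integralHodgeClassesIn Φ (2 * p) p).addSubgroupOf (integralForms Φ (2 * p))))).restrict ((B.restrict (AddSubgroup.toIntSubmodule ((integralHodgeClassesIn Φ (2 * p) p).addSubgroupOf (integralForms Φ (2 * p))))).orthogonal Λ))).det ≠ 0 ∧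
      (LinearMap.BilinForm.toMatrix b (B.restrict (AddSubgroup.toIntSubmodule ((integralHodgeClassesIn Φ (2 * p) p).addSubgroupOf (integralForms Φ (2 * p)))))).det ≠ 0 := by
  have hn₀ : 2 * p + (2 * 0 + 2 * p) = n := by omega
  have hg₀ : p + (0 + p) = j + 2 := by omega
  have hB₀ := eq_poincarePairing_wedgePow_zero_wedge_of_eq_poincarePairing₉₉ Φ e (ofRealForm η) hn hn₀ hB
  have hγ0 := wedgePow_zero_eq_content_smul₉₉ (ofRealForm η) d (Nat.zero_le (j + 2))
  have h := hd.index_range_mul_det_orthogonal_minimalClass_eq hη hp (Nat.zero_le _) hg₀ hγ0 e hn₀ hB₀ γM hγM Λ hΛ b c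
  have heven : Even j := ⟨p - 1, by omega⟩
  have hsj : orientationSign Φ e * (-1) ^ j = orientationSign Φ e := by rw [heven.neg_one_pow, mul_one]
  have h1 := h.1.trans (congrArg (fun t : ℤ ↦ t * ((Λ ⊔ (B.restrict (AddSubgroup.toIntSubmodule ((integralHodgeClassesIn Φ (2 * p) p).addSubgroupOf (integralForms Φ (2 * p))))).orthogonal Λ).toAddSubgroup.index : ℤ) *
    (LinearMap.BilinForm.toMatrix b (B.restrict (AddSubgroup.toIntSubmodule ((integralHodgeClassesIn Φ (2 * p) p).addSubgroupOf (integralForms Φ (2 * p)))))).det) hsj)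
  have hsq := (hd.orientationSign_mul_apply_minimalClass_self_eq_choose_mul hη hp hg e hn hB (γM : ↥(integralForms Φ (2 * p))) hγM).1
  exact ⟨h1, arith_sign₉₉ h.2.1 hsq, h.2.2.1, h.2.2.2.2.1, h.2.2.2.2.2⟩

end Middle

end Literature.Geometry.Kaehler.ComplexTorus

end
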